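import Summits.BirchSwinnertonDyer.BirchSwinnertonDyer.Theses.VerticalContact

/-!
# Birth skeleton (BC3) for crux `VerticalContact` — item stmt-BirchSwinnertonDyer-18130, route VerticalContact (rev 4)

Registered by the skeleton-registrar seat `planner-skel-stmt-BirchSwinnertonDyer-18130-0` (2026-08-17).
Published as `Cruxes/VerticalContact/Lines/birth.lean`; card `Lines/birth.md`.

The crux (rev 4: coefficient data `F, 𝔓, ι, e, e'` under `∀ N`; on-branch weight clause
`2(p-1)p^N·h_K ∣ k-2`) says: for every elliptic `E/ℚ` (global minimal `W`) with a multiplicative prime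
there is an admissible definite datum `(p, K, N⁺, N⁻, (a,b,O), ψ, I₁, a₀, α)`, a contact order `m` with
`2m ≤ r_an(E) + r_an(E^{d_K})`, `r_an(E^{d_K}) ≤ 1`, and `C`, such that at every depth `N` some
admissible weight-`k` quaternionic eigenform `Φ ≡ f_E (mod p^{N+1})` has twisted Gross period of
depth `2(v_𝔓(P) − content) ≤ 2m(N+1) + C`.

## The cut (two named stubs, composition `VerticalContact_of` proved)

* `stub_contactOrderExists` — **SUPPLY + A FINITE TWO-SIDED CONTACT ORDER ALONG THE EXACT-DEPTH LINE.**
  Some admissible datum with `r_an(E^{d_K}) ≤ 1` carries, at every depth `N`, an admissible form of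
  EXACT depth (`¬ p^{N+1} ∣ k-2`, i.e. `v_p(k-2) = N` since `p ∤ 2(p-1)h_K`) whose typed period obeys a
  two-sided linear law `2m₀(N+1) − C ≤ depth ≤ 2m₀(N+1) + C` for SOME slope `m₀ : ℕ`.
  Content: existence of the set-up (Serre / ordinary primes / CRT for `K` / Hilbert symbols / Eichler
  orders / Eichler's optimal embeddings — theorems), a twist with `r_an(E^{d_K}) ≤ 1` and prescribed
  splitting (BumpFriedbergHoffstein1990, MurtyMurty1991, Waldspurger — theorems), the Hida-family member
  at every arithmetic weight `k = 2 + 2(p-1)p^N h_K t`, `p ∤ t`, transferred to the definite algebra with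
  `p`-integral normalisation (Hida 1986, Jacquet–Langlands/Eichler, ChidaHsieh2014, CastellaKimLongo2017
  Thm 3.4 — theorems), interpolation of the content-normalised typed periods by a germ `J ∈ 𝓞⟦T⟧` on the
  branch (LongoVigni2010 §6, CastellaKimLongo2017 Thm 3.13 — literature), and NON-VANISHING of that germ
  (`J ≠ 0`: open in general — Greenberg / Cornut–Vatsal type along the slanted arc `(k, ξ_k)`; known in
  `r_an(E/K) = 0` by Gross's formula; numerically two-sided with slope exactly `1`, `C = 0`, for 37a1 at
  (5, ℚ(√−19)), N = 0, 1 — `Disproof.slopeTable`).  Given `J ≠ 0` of order `o` at `T = 0`, leading-term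
  domination (landed helper `Theorems/VerticalContactVerticalContactDepthShift.lean`) gives the two-sided
  law with `m₀ = o` at exact depth.  Size: XL.
* `stub_contactOrderBound` — **THE CONTACT INEQUALITY.**  For every admissible datum and every
  `(m₀, C)`: if at every depth `N` some exact-depth admissible form has depth within `2m₀(N+1) ± C`,
  then `2m₀ ≤ r_an(E) + r_an(E^{d_K})`.  Exact depth makes `m₀` an invariant: for large `N` the only
  admissible eigen-systems are the members of the `f_E`-branch (`ρ̄_{E,p}` surjective, étaleness at
  weight 2), and at `v_p(k-2) = N` their content-normalised depth is `2o(N+1) + O(1)` with `o = ord_{T=0} J`,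
  so the hypothesis forces `m₀ = o`; WITHOUT exact depth a form of exact depth `t(N+1) − 1` would be
  admissible at depth `N` and fake any multiple `t·o` of the true order (depth aliasing, D4 below) — the
  reason the census split `ContactOrderExists/ContactOrderBound` (CensusSketch.lean) is re-typed here.
  This stub is the conjectural half of the route (Disegni2022 Conj. Pf on the slanted arc, rank-1 case
  BertoliniDarmon2007 / Castella2016, rank 0 Gross1987): `2·(contact order) ≤ r_an(E/K)`.  Size: open.

`VerticalContact_of` is bookkeeping: take the datum, `m := m₀`, `C`, and at each depth the supplied
form with its upper bound; feed the two-sided exact-depth law to the inequality stub for `2m₀ ≤ r̃_an`.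

## Disproof used (Cruxes/VerticalContact/Disproof.lean, cycle 1; no `_false_without_` theorem landed)
* §1 `bound_forces_period_ne_zero`: the depth clause forces `P_N ≠ 0` — honoured at `stub_contactOrderExists`,
  which must supply NON-VANISHING typed periods at every exact depth (the germ `J ≠ 0` plus zero-dodging in
  `t`, `p ∤ t`); the redundancy `period_ne_zero_imp_exists_value_ne_zero` is harmless (the form clause is
  carried verbatim).
* §1b D3 (character leakage): dead with rev 4 — both stubs carry the on-branch clause
  `2 * (p - 1) * p ^ N * hK ∣ k - 2` verbatim (`repaired_weight_kills_character`, `unit_pow_totient_prime_pow`).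
* §3 tightness (37a1: depth exactly `2(N+1)`, slope 1, `C = 0`; 19a1: slope 0): the two-sided law of
  `stub_contactOrderExists` is the typed form of exactly this observation; `stub_contactOrderBound` predicts
  slope ≤ 1 for 389a1 (kill signal: slope ≥ 2 at two admissible `(p, K)`, job j026225 pending).
* D4 (new, this file): DEPTH ALIASING — admissibility at depth `N` is monotone in the true depth
  (`Form N' → Form N` for `N' ≥ N`), so any statement quantifying over ALL admissible forms at depth `N`
  must pin `v_p(k-2) = N`; both stubs do (`¬ p ^ (N + 1) ∣ k - 2`).  The crux itself is existential in the
  form and needs no pin.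
* Negatives index (`ledger negatives --problem BirchSwinnertonDyer`): no entry bears on either stub.

Both stubs are stated in the decl's own inline-`let` vocabulary (Mathlib only), so a prover can restate
them verbatim in `Theorems/` (cf. `Cruxes/VerticalSelmerBound/Lines/toric_control.lean`).  The signatures are
whitespace-compacted (`k-2`, `(p:ℕ)`, `x∈J` …) only to stay under the 3900/4000-character limits of the stub
registry; copy them from `ledger workitem stubs stmt-BirchSwinnertonDyer-18130`.
-/

namespace Summit.BirchSwinnertonDyer.BirchSwinnertonDyer.Cruxes.VerticalContact.Birth

open scoped BigOperators Topology Manifold Classical MeasureTheory ProbabilityTheory Matrix InnerProductSpace ComplexConjugate ContinuousMap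
open Filter Set Function TopologicalSpace MeasureTheory
open Literature
open Summit.BirchSwinnertonDyer.BirchSwinnertonDyer.Theses.VerticalContact

set_option linter.dupNamespace false

/-- **Stub 1 (XL): supply of an admissible datum with a finite two-sided contact order along the
exact-depth line.**  For every elliptic `E/ℚ` (global minimal `W`) with a multiplicative prime there are
an admissible definite datum `(p, K, N⁺, N⁻, a, b, O, ψ, I₁, a₀, α)` (the crux's data clause verbatim) with
`r_an(E^{d_K}) ≤ 1`, a slope `m₀` and a constant `C` such that at every depth `N` some coefficient datum
`(F, 𝔓, ι, e, e')` and some admissible weight-`k` eigenform `Φ` (the crux's form clause verbatim) of EXACT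
depth `¬ p^(N+1) ∣ k - 2` has typed twisted Gross period `P` with
`2m₀(N+1) − C ≤ 2(v_𝔓(P) − content) ≤ 2m₀(N+1) + C` (upper bound: the crux's depth clause with `m₀`;
lower bound: one admissible reference value `Φ(I₀)(e₀)` divides `P²` to depth `2m₀(N+1) − C`).
Hida family + Jacquet–Langlands + BFH/MM twist + Gross points (theorems); interpolation by a germ and its
NON-VANISHING (open in general; Gross1987 in rank 0); leading-term domination at exact depth. -/
theorem stub_contactOrderExists :
    ∀ (W:WeierstrassCurve ℚ) [W.IsElliptic] [W.IsGloballyMinimal], (∃ (q:ℕ) (_:Fact q.Prime), W.HasMultiplicativeReductionAtPrime q) → ∃ (p:ℕ) (_:Fact p.Prime) (K:Type) (_:Field K) (_:NumberField K) (Nplus Nminus:ℕ) (a b:ℚ), let B := QuaternionAlgebra ℚ a 0 b; let R := NumberField.RingOfIntegers K; ∃ (O:Subring B) (ψ:K →ₐ[ℚ] B) (I₁:Submodule ℤ B) (a₀:ClassGroup R → nonZeroDivisors (Ideal R)) (α:ClassGroup R → R) (m₀ C:ℕ), let Λ := Submodule ℤ B; let hK := NumberField.classNumber K; let dK := NumberField.discr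 K; let spl:ℕ → ℕ := fun q => ((Ideal.span {(q:ℤ)}).primesOver R).ncard; let RI:Set Λ := {J | J.FG ∧ (∀ d:B, ∃ n:ℤ, n≠0 ∧ n•d∈J) ∧ (∀ x:B, (∀ y∈J, y*x∈J)↔x∈O) ∧ ∃ J':Λ, (∀ x:B, x∈J*J'↔∀ y∈J, x*y∈J) ∧ (∀ x:B, x∈J'*J↔x∈O)}; let PT:Λ → Prop := fun I => ∃ n₀:ℕ, n₀.Coprime p ∧ (∀ x∈O, (n₀:ℤ)•x∈I) ∧ ∀ x∈I, (n₀:ℤ)•x∈O; let L:ClassGroup R → Λ := fun c => Submodule.span ℤ ((fun x:R => ψ (x:K)) '' (a₀ c).1)*I₁; let HG:Λ → Prop := fun J => J∈RI ∧ (∀ x:R, ∀ y∈J, ψ (x:K)*y∈J) ∧ ∀ x:K, (∀ y∈J, ψ x*y∈J) → ∃ z:R, (z:K)=x; ((5≤p ∧ W.HasGoodReductionAtPrime p ∧ ¬ (p:ℤ)∣W.frobeniusTrace p ∧ W.HasSurjectiveModNGaloisRep p ∧ ¬ p∣6*hK ∧ Int.gcd dK (W.conductorNorm ℤ*p)=1)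 ∧ (Module.finrank ℚ K=2 ∧ NumberField.IsTotallyComplex K ∧ dK < -4 ∧ spl p=2) ∧ (W.conductorNorm ℤ=Nplus*Nminus ∧ Nat.Coprime Nplus Nminus ∧ Squarefree Nminus ∧ Odd Nminus.primeFactors.card ∧ (∀ q:ℕ, q.Prime → q∣Nplus → spl q=2) ∧ (∀ q:ℕ, q.Prime → q∣Nminus → spl q=1 ∧ ¬ (p:ℤ)∣padicValRat q W.Δ)) ∧ (a < 0 ∧ b < 0 ∧ (∀ (q:ℕ) [Fact q.Prime], (∀ x:QuaternionAlgebra ℚ_[q] (a:ℚ_[q]) 0 (b:ℚ_[q]), x≠0 → IsUnit x)↔q∣Nminus) ∧ ∃ O₁ O₂:Subring B, (∀ S:Subring B, (S=O₁ ∨ S=O₂) → (S.toAddSubgroup.FG ∧ (∀ d:B, ∃ n:ℤ, n≠0 ∧ n•d∈S) ∧ ∀ S':Subring B, S'.toAddSubgroup.FG → S≤S' → S'=S)) ∧ O=O₁ ⊓ O₂ ∧ O.toAddSubgroup.relIndex O₁.toAddSubgroup=Nplus) ∧ (HG I₁ ∧ ∀ c, ClassGroup.mk0 (a₀ c)=c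 ∧ IsCoprime (a₀ c).1 (Ideal.span {(p:R)}) ∧ Ideal.span {α c}=(a₀ c).1^hK ∧ HG (L c) ∧ PT (L c))) ∧ (W.quadraticTwist (dK:ℚ)).analyticRank≤1 ∧ ∀ N:ℕ, ∃ (F:Type) (_:Field F) (_:NumberField F) (_:Algebra K F) (𝔓:IsDedekindDomain.HeightOneSpectrum (NumberField.RingOfIntegers F)) (ι:B →ₐ[ℚ] Matrix (Fin 2) (Fin 2) F) (e e':Fin 2 → F) (k:ℕ) (lam:ℕ → F) (Φ:Λ → MvPolynomial (Fin 2) F), let val := 𝔓.valuation F; let PR:(Fin 2 → F) → Prop := fun w => (∀ i, val (w i)≤1) ∧ ∃ i, val (w i)=1; let ρ:Bˣ → MvPolynomial (Fin 2) F → MvPolynomial (Fin 2) F := fun β P => MvPolynomial.aeval (fun j:Fin 2 => ∑ i:Fin 2, MvPolynomial.X (R := F) i*MvPolynomial.C (ι β.1 i j)) P; (((p:NumberField.RingOfIntegers F)∈𝔓.asIdeal ∧ ∀ x∈O, ∀ i j, val (ι x i j)≤1) ∧ ((∀ t, Matrix.vecMul e (ι (ψ t))=(algebraMap K F t)•e)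 ∧ (∀ t, Matrix.vecMul e' (ι (ψ t))=(algebraMap K F (Algebra.trace ℚ K t)-algebraMap K F t)•e') ∧ (∀ i, val (e i)≤1) ∧ (∀ i, val (e' i)≤1) ∧ val (e 0*e' 1-e 1*e' 0)=1)) ∧ ((2 < k ∧ 2*(p-1)*p^N∣k-2 ∧ 2*(p-1)*p^N*hK∣k-2) ∧ (∀ I∈RI, (Φ I).IsHomogeneous (k-2)) ∧ (∀ (β:Bˣ), ∀ I∈RI, Φ (I.map (AddMonoidHom.mulLeft β.1).toIntLinearMap)=ρ β (Φ I)) ∧ (∀ q:ℕ, q.Prime → ¬ q∣Nplus*Nminus → ∀ I∈RI, ∑ᶠ J∈{J:Λ | J≤I ∧ J.toAddSubgroup.relIndex I.toAddSubgroup=q^2 ∧ ∀ y∈J, ∀ x∈O, y*x∈J}, Φ J=lam q•Φ I) ∧ (∀ q:ℕ, q.Prime → ¬ q∣Nplus*Nminus*p → val (lam q-(W.frobeniusTrace q:F))≤val (p:F)^(N+1)) ∧ val (lam p)=1 ∧ ∃ I∈RI, PT I ∧ Φ I≠0) ∧ (¬ p^(N+1)∣k-2) ∧ (∀ I₀∈RI,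 PT I₀ → ∀ e₀:Fin 2 → F, PR e₀ → ∀ j:ℕ, val (∑ c, (algebraMap K F (α c:K))⁻¹^((k-2) / hK)*MvPolynomial.eval e (Φ (L c)))^2≤val (MvPolynomial.eval e₀ (Φ I₀))^2*val (p:F)^j → j≤2*m₀*(N+1)+C) ∧ ∃ I₀∈RI, PT I₀ ∧ ∃ e₀:Fin 2 → F, PR e₀ ∧ val (∑ c, (algebraMap K F (α c:K))⁻¹^((k-2) / hK)*MvPolynomial.eval e (Φ (L c)))^2≤val (MvPolynomial.eval e₀ (Φ I₀))^2*val (p:F)^(2*m₀*(N+1)-C) := by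
  sorry

/-- **Stub 2 (the contact inequality, open): an observed exact-depth contact order is at most half the
analytic rank of `E/K`.**  For every admissible datum (the crux's data clause verbatim, universally
quantified) and every `(m₀, C)`: if at every depth `N` some coefficient datum and some admissible form of
exact depth `¬ p^(N+1) ∣ k - 2` has typed period of depth within `2m₀(N+1) ± C` (two-sided), then
`2 m₀ ≤ r_an(E) + r_an(E^{d_K})`.  Exact depth pins `m₀` to the order of vanishing at weight 2 of the
period germ on the `f_E`-branch (no depth aliasing), so this is precisely "2·(contact order) ≤ r_an(E/K)"
(Disegni2022 Conj. Pf on the slanted arc; BertoliniDarmon2007 / Castella2016 in rank 1; Gross1987 in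
rank 0).  Vacuous — hence harmless — at data whose period line vanishes identically. -/
theorem stub_contactOrderBound :
    ∀ (W:WeierstrassCurve ℚ) [W.IsElliptic] [W.IsGloballyMinimal] (p:ℕ) [Fact p.Prime] (K:Type) [Field K] [NumberField K] (Nplus Nminus:ℕ) (a b:ℚ), let B := QuaternionAlgebra ℚ a 0 b; let R := NumberField.RingOfIntegers K; ∀ (O:Subring B) (ψ:K →ₐ[ℚ] B) (I₁:Submodule ℤ B) (a₀:ClassGroup R → nonZeroDivisors (Ideal R)) (α:ClassGroup R → R), let Λ := Submodule ℤ B; let hK := NumberField.classNumber K; let dK := NumberField.discr K; let spl:ℕ → ℕ := fun q => ((Ideal.span {(q:ℤ)}).primesOver R).ncard; let RI:Set Λ := {J | J.FG ∧ (∀ d:B, ∃ n:ℤ, n≠0 ∧ n•d∈J) ∧ (∀ x:B, (∀ y∈J, y*x∈J)↔x∈O) ∧ ∃ J':Λ, (∀ x:B, x∈J*J'↔∀ y∈J, x*y∈J) ∧ (∀ x:B, x∈J'*J↔x∈O)}; let PT:Λ → Prop := fun I => ∃ n₀:ℕ, n₀.Coprime p ∧ (∀ x∈O, (n₀:ℤ)•x∈I)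 ∧ ∀ x∈I, (n₀:ℤ)•x∈O; let L:ClassGroup R → Λ := fun c => Submodule.span ℤ ((fun x:R => ψ (x:K)) '' (a₀ c).1)*I₁; let HG:Λ → Prop := fun J => J∈RI ∧ (∀ x:R, ∀ y∈J, ψ (x:K)*y∈J) ∧ ∀ x:K, (∀ y∈J, ψ x*y∈J) → ∃ z:R, (z:K)=x; ((5≤p ∧ W.HasGoodReductionAtPrime p ∧ ¬ (p:ℤ)∣W.frobeniusTrace p ∧ W.HasSurjectiveModNGaloisRep p ∧ ¬ p∣6*hK ∧ Int.gcd dK (W.conductorNorm ℤ*p)=1) ∧ (Module.finrank ℚ K=2 ∧ NumberField.IsTotallyComplex K ∧ dK < -4 ∧ spl p=2) ∧ (W.conductorNorm ℤ=Nplus*Nminus ∧ Nat.Coprime Nplus Nminus ∧ Squarefree Nminus ∧ Odd Nminus.primeFactors.card ∧ (∀ q:ℕ, q.Prime → q∣Nplus → spl q=2) ∧ (∀ q:ℕ, q.Prime → q∣Nminus → spl q=1 ∧ ¬ (p:ℤ)∣padicValRat q W.Δ)) ∧ (a < 0 ∧ b < 0 ∧ (∀ (q:ℕ) [Fact q.Prime],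 (∀ x:QuaternionAlgebra ℚ_[q] (a:ℚ_[q]) 0 (b:ℚ_[q]), x≠0 → IsUnit x)↔q∣Nminus) ∧ ∃ O₁ O₂:Subring B, (∀ S:Subring B, (S=O₁ ∨ S=O₂) → (S.toAddSubgroup.FG ∧ (∀ d:B, ∃ n:ℤ, n≠0 ∧ n•d∈S) ∧ ∀ S':Subring B, S'.toAddSubgroup.FG → S≤S' → S'=S)) ∧ O=O₁ ⊓ O₂ ∧ O.toAddSubgroup.relIndex O₁.toAddSubgroup=Nplus) ∧ (HG I₁ ∧ ∀ c, ClassGroup.mk0 (a₀ c)=c ∧ IsCoprime (a₀ c).1 (Ideal.span {(p:R)}) ∧ Ideal.span {α c}=(a₀ c).1^hK ∧ HG (L c) ∧ PT (L c))) → ∀ m₀ C:ℕ, (∀ N:ℕ, ∃ (F:Type) (_:Field F) (_:NumberField F) (_:Algebra K F) (𝔓:IsDedekindDomain.HeightOneSpectrum (NumberField.RingOfIntegers F)) (ι:B →ₐ[ℚ] Matrix (Fin 2) (Fin 2) F) (e e':Fin 2 → F) (k:ℕ) (lam:ℕ → F) (Φ:Λ → MvPolynomial (Fin 2) F), let val :=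 𝔓.valuation F; let PR:(Fin 2 → F) → Prop := fun w => (∀ i, val (w i)≤1) ∧ ∃ i, val (w i)=1; let ρ:Bˣ → MvPolynomial (Fin 2) F → MvPolynomial (Fin 2) F := fun β P => MvPolynomial.aeval (fun j:Fin 2 => ∑ i:Fin 2, MvPolynomial.X (R := F) i*MvPolynomial.C (ι β.1 i j)) P; (((p:NumberField.RingOfIntegers F)∈𝔓.asIdeal ∧ ∀ x∈O, ∀ i j, val (ι x i j)≤1) ∧ ((∀ t, Matrix.vecMul e (ι (ψ t))=(algebraMap K F t)•e) ∧ (∀ t, Matrix.vecMul e' (ι (ψ t))=(algebraMap K F (Algebra.trace ℚ K t)-algebraMap K F t)•e') ∧ (∀ i, val (e i)≤1) ∧ (∀ i, val (e' i)≤1) ∧ val (e 0*e' 1-e 1*e' 0)=1)) ∧ ((2 < k ∧ 2*(p-1)*p^N∣k-2 ∧ 2*(p-1)*p^N*hK∣k-2) ∧ (∀ I∈RI, (Φ I).IsHomogeneous (k-2)) ∧ (∀ (β:Bˣ), ∀ I∈RI, Φ (I.map (AddMonoidHom.mulLeft β.1).toIntLinearMap)=ρ β (Φ I)) ∧ (∀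 q:ℕ, q.Prime → ¬ q∣Nplus*Nminus → ∀ I∈RI, ∑ᶠ J∈{J:Λ | J≤I ∧ J.toAddSubgroup.relIndex I.toAddSubgroup=q^2 ∧ ∀ y∈J, ∀ x∈O, y*x∈J}, Φ J=lam q•Φ I) ∧ (∀ q:ℕ, q.Prime → ¬ q∣Nplus*Nminus*p → val (lam q-(W.frobeniusTrace q:F))≤val (p:F)^(N+1)) ∧ val (lam p)=1 ∧ ∃ I∈RI, PT I ∧ Φ I≠0) ∧ (¬ p^(N+1)∣k-2) ∧ (∀ I₀∈RI, PT I₀ → ∀ e₀:Fin 2 → F, PR e₀ → ∀ j:ℕ, val (∑ c, (algebraMap K F (α c:K))⁻¹^((k-2) / hK)*MvPolynomial.eval e (Φ (L c)))^2≤val (MvPolynomial.eval e₀ (Φ I₀))^2*val (p:F)^j → j≤2*m₀*(N+1)+C) ∧ ∃ I₀∈RI, PT I₀ ∧ ∃ e₀:Fin 2 → F, PR e₀ ∧ val (∑ c, (algebraMap K F (α c:K))⁻¹^((k-2) / hK)*MvPolynomial.eval e (Φ (L c)))^2≤val (MvPolynomial.eval e₀ (Φ I₀))^2*val (p:F)^(2*m₀*(N+1)-C))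 → 2*m₀≤W.analyticRank+(W.quadraticTwist (dK:ℚ)).analyticRank := by
  sorry

namespace Statement

/-- The statement of `stub_contactOrderExists`, by name (skeleton protocol: composition hypotheses are
declared stubs). -/
abbrev stub_contactOrderExists : Prop := type_of% @Birth.stub_contactOrderExists
/-- The statement of `stub_contactOrderBound`, by name. -/
abbrev stub_contactOrderBound : Prop := type_of% @Birth.stub_contactOrderBound

end Statement

/-- **Composition (kernel-checked, sorry-free): the two stubs give the crux `VerticalContact`
(item stmt-BirchSwinnertonDyer-18130) BY NAME.**  Take the supplied datum, `m := m₀` and `C`; the rank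
bound `2m₀ ≤ r_an(E) + r_an(E^{d_K})` is the inequality stub applied to the two-sided exact-depth law;
at each depth keep the supplied form and its upper bound (exactness and the lower bound are dropped). -/
theorem VerticalContact_of (hA : Statement.stub_contactOrderExists)
    (hB : Statement.stub_contactOrderBound) :
    Summit.BirchSwinnertonDyer.BirchSwinnertonDyer.Theses.VerticalContact.VerticalContact := by
  intro W _ _ hmult
  obtain ⟨p, hp, K, hFK, hNK, Nplus, Nminus, a, b, O, ψ, I₁, a₀, α, m₀, C, hD, htw, hN⟩ := hA W hmult
  refine ⟨p, hp, K, hFK, hNK, Nplus, Nminus, a, b, ?_⟩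
  intro B R
  refine ⟨O, ψ, I₁, a₀, α, m₀, C, ?_⟩
  intro Λ hK dK spl RI PT L HG
  refine ⟨hD, ⟨?_, htw⟩, fun N => ?_⟩
  · exact hB W p K Nplus Nminus a b O ψ I₁ a₀ α hD m₀ C hN
  · obtain ⟨F, hF, hNF, hKF, 𝔓, ι, e, e', k, lam, Φ, hFD, hForm, -, hLE, -⟩ := hN N
    exact ⟨F, hF, hNF, hKF, 𝔓, ι, e, e', k, lam, Φ, hFD, hForm, hLE⟩

end Summit.BirchSwinnertonDyer.BirchSwinnertonDyer.Cruxes.VerticalContact.Birth
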